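import Mathlib.GroupTheory.Perm.Sign
import Mathlib.Algebra.BigOperators.Fin
import Mathlib.Algebra.BigOperators.Ring.Finset
import Literature.NumberTheory.GaloisRepresentations.Pseudocharacter
import HarnessLib

/-!
# The Frobenius functional `S_n(T)` is symmetric for central `T`

Topic `NumberTheory/GaloisRepresentations`; a proofs-only companion of `Pseudocharacter.lean`.
There `S_n(T) = frobeniusS T n` is *defined* by Rouquier's recursion in the last variable
[cite: Rouquier1996, Lemme 2.2 (1)]; Rouquier defines `S_n(f)(x) = Σ_{σ ∈ 𝔖_n} ε(σ) (σ·f)(x)` and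
observes (p. 572: "`(σ·f)(τ·x) = ((τ⁻¹στ)·f)(x)`. Il en résulte que `S_n(f)` est symétrique") that
it is a symmetric function of `x ∈ Rⁿ` as soon as `f` is central.  Starting from the recursion
instead, we prove this symmetry directly:

* `frobeniusS_snoc_snoc_comm`: `S_{k+2}(T)(x, y, z) = S_{k+2}(T)(x, z, y)` (transposition of the two
  last slots) — expand the recursion twice; every term is manifestly symmetric except `T(yz)`,
  where centrality `T(yz) = T(zy)` is used;
* `frobeniusS_snoc_comp_perm`: permuting the first `n` slots of `S_{n+1}` is harmless once `S_n` is
  symmetric (re-index the sum in the recursion);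
* `frobeniusS_comp_perm`: **`S_n(T)(x ∘ σ) = S_n(T)(x)` for every `σ ∈ 𝔖_n` and central `T`**
  (induction on `n`; `𝔖_{k+2}` is generated by the transpositions, each of which is a conjugate of
  the two kinds above, `Equiv.Perm.swap_induction_on`);
* `frobeniusS_update_const_eq`: the special case used in the proof of Taylor's theorem
  (`Hida2000_thm_2_18_1`): `S_n(T)(c, …, v, …, c)` does not depend on the slot carrying `v`.

Valid for any monoid `G` and commutative ring `A` (no invertibility of `n!`).  Written as Part A of
the discharge of `Literature.NumberTheory.GaloisRepresentations.Hida2000_thm_2_18_1` (Taylor's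
theorem), whose Cayley–Hamilton step [cite: Rouquier1996, Lemme 2.13] evaluates `S_{n+1}(T)` at
`(x, …, x, y)` and needs this symmetry to collapse Rouquier's recursion.

## References

* R. Rouquier, *Caractérisation des caractères et pseudo-caractères*, J. Algebra 180 (1996)
  571–586, §2 p. 572 and Lemme 2.2. [Rouquier1996]
* R. Taylor, *Galois representations associated to Siegel modular forms of low weight*, Duke
  Math. J. 63 (1991) 281–332, §1. [Taylor1991]
-/

namespace Literature.NumberTheory.GaloisRepresentations

open Function Equiv Finset

universe u v

variable {G : Type u} [Monoid G] {A : Type v} [CommRing A]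

section Symmetric

/-- Rouquier's recursion written with `Fin.snoc`. [cite: Rouquier1996, Lemme 2.2 (1)] -/
lemma frobeniusS_snoc (T : G → A) (n : ℕ) (y : Fin n → G) (z : G) :
    frobeniusS T (n + 1) (Fin.snoc y z) =
      T z * frobeniusS T n y - ∑ i : Fin n, frobeniusS T n (update y i (y i * z)) := by
  rw [frobeniusS_succ, Fin.init_snoc, Fin.snoc_last]
  simp only [Fin.snoc_castSucc]

/-- Permuting the first `n` slots of `S_{n+1}`, given the symmetry of `S_n`. [folklore] -/
lemma frobeniusS_snoc_comp_perm (T : G → A) (n : ℕ)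
    (ih : ∀ (σ : Perm (Fin n)) (x : Fin n → G), frobeniusS T n (x ∘ σ) = frobeniusS T n x)
    (y : Fin n → G) (z : G) (ρ : Perm (Fin n)) :
    frobeniusS T (n + 1) (Fin.snoc (y ∘ ρ) z) = frobeniusS T (n + 1) (Fin.snoc y z) := by
  rw [frobeniusS_snoc, frobeniusS_snoc, ih]
  congr 1
  have key : ∀ i, frobeniusS T n (update (y ∘ ρ) i ((y ∘ ρ) i * z)) =
      frobeniusS T n (update y (ρ i) (y (ρ i) * z)) := by
    intro i
    rw [comp_apply, ← update_comp_eq_of_injective y ρ.injective i, ih]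
  simp_rw [key]
  exact Equiv.sum_comp ρ (fun j => frobeniusS T n (update y j (y j * z)))

/-- The double sum appearing in the second-order expansion of `S_{k+2}`, split into its
diagonal and off-diagonal parts. [folklore] -/
private lemma doubleSum_split (T : G → A) (k : ℕ) (x : Fin k → G) (y z : G) :
    ∑ j : Fin k, ∑ l : Fin k, frobeniusS T k
        (update (update x j (x j * z)) l (update x j (x j * z) l * y)) =
      ∑ j : Fin k, frobeniusS T k (update x j (x j * z * y)) +
        ∑ j : Fin k, ∑ l : Fin k,
          if l = j then 0 else frobeniusS T k (update (update x j (x j * z)) l (x l * y)) := by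
  rw [← sum_add_distrib]
  refine sum_congr rfl fun j _ => ?_
  have hsplit : ∀ l : Fin k, frobeniusS T k
      (update (update x j (x j * z)) l (update x j (x j * z) l * y)) =
        (if l = j then frobeniusS T k (update x j (x j * z * y)) else 0) +
          (if l = j then 0 else frobeniusS T k (update (update x j (x j * z)) l (x l * y))) := by
    intro l
    by_cases hl : l = j
    · subst hl
      simp only [update_self, update_idem, if_true, add_zero]
    · simp only [update_of_ne hl, hl, if_false, zero_add]
  simp_rw [hsplit, sum_add_distrib, sum_ite_eq' univ j, mem_univ, if_true]

/-- The off-diagonal part of the double sum is symmetric in `(y, z)`. [folklore] -/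
private lemma offDiag_comm (T : G → A) (k : ℕ) (x : Fin k → G) (y z : G) :
    ∑ j : Fin k, ∑ l : Fin k,
        (if l = j then 0 else frobeniusS T k (update (update x j (x j * z)) l (x l * y))) =
      ∑ j : Fin k, ∑ l : Fin k,
        (if l = j then 0 else frobeniusS T k (update (update x j (x j * y)) l (x l * z))) := by
  rw [sum_comm]
  refine sum_congr rfl fun l _ => sum_congr rfl fun j _ => ?_
  by_cases h : j = l
  · subst h; simp
  · rw [if_neg h, if_neg (Ne.symm h), update_comm h]

/-- Second-order expansion of `S_{k+2}(x, y, z)` in the two last slots. [folklore] -/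
private lemma frobeniusS_snoc_snoc_expand (T : G → A) (k : ℕ) (x : Fin k → G) (y z : G) :
    frobeniusS T (k + 2) (Fin.snoc (Fin.snoc x y : Fin (k + 1) → G) z) =
      T z * (T y * frobeniusS T k x - ∑ j : Fin k, frobeniusS T k (update x j (x j * y))) -
        ((∑ j : Fin k, (T y * frobeniusS T k (update x j (x j * z)) -
            ∑ l : Fin k, frobeniusS T k
              (update (update x j (x j * z)) l (update x j (x j * z) l * y)))) +
          (T (y * z) * frobeniusS T k x -
            ∑ l : Fin k, frobeniusS T k (update x l (x l * (y * z))))) := by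
  rw [frobeniusS_snoc, frobeniusS_snoc, Fin.sum_univ_castSucc]
  simp only [Fin.snoc_castSucc, Fin.snoc_last, Fin.update_snoc_last, ← Fin.snoc_update,
    frobeniusS_snoc]

/-- `S_{k+2}` is symmetric in its last two arguments when `T` is central. [cite: Rouquier1996, §2 p. 572] -/
lemma frobeniusS_snoc_snoc_comm (T : G → A) (hT : ∀ a b : G, T (a * b) = T (b * a)) (k : ℕ)
    (x : Fin k → G) (y z : G) :
    frobeniusS T (k + 2) (Fin.snoc (Fin.snoc x y : Fin (k + 1) → G) z) =
      frobeniusS T (k + 2) (Fin.snoc (Fin.snoc x z : Fin (k + 1) → G) y) := by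
  rw [frobeniusS_snoc_snoc_expand, frobeniusS_snoc_snoc_expand, sum_sub_distrib, sum_sub_distrib,
    doubleSum_split, doubleSum_split, offDiag_comm T k x y z, hT y z]
  simp only [mul_assoc, ← mul_sum]
  ring

/-- **`S_n(T)` is symmetric for central `T`**: `S_n(T)(x ∘ σ) = S_n(T)(x)` for every permutation
`σ` of the slots. [cite: Rouquier1996, §2 p. 572] -/
theorem frobeniusS_comp_perm (T : G → A) (hT : ∀ a b : G, T (a * b) = T (b * a)) :
    ∀ (n : ℕ) (σ : Perm (Fin n)) (x : Fin n → G), frobeniusS T n (x ∘ σ) = frobeniusS T n x := by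
  intro n
  induction n using Nat.twoStepInduction with
  | zero => intro σ x; rw [Subsingleton.elim σ 1]; rfl
  | one => intro σ x; rw [Subsingleton.elim σ 1]; rfl
  | more k _ ih =>
    -- `ih` : symmetry of `S_{k+1}`; goal: symmetry of `S_{k+2}`.
    -- (i) permutations of the first `k+1` slots, as a statement about `x ∘ σ` for `σ` fixing `last`.
    have hcast : ∀ (ρ : Perm (Fin (k + 1))) (x : Fin (k + 2) → G),
        frobeniusS T (k + 2) (fun i => x (Fin.lastCases (Fin.last (k + 1))
          (fun j => Fin.castSucc (ρ j)) i)) = frobeniusS T (k + 2) x := by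
      intro ρ x
      have hx : (fun i => x (Fin.lastCases (motive := fun _ => Fin (k + 2)) (Fin.last (k + 1))
          (fun j => Fin.castSucc (ρ j)) i)) = Fin.snoc (Fin.init x ∘ ρ) (x (Fin.last (k + 1))) := by
        ext i
        cases i using Fin.lastCases with
        | last => simp
        | cast j => simp [Fin.init]
      rw [hx, frobeniusS_snoc_comp_perm T (k + 1) ih, Fin.snoc_init_self]
    -- swaps of two non-last slots
    have hswap_cast : ∀ (a b : Fin (k + 1)) (x : Fin (k + 2) → G),
        frobeniusS T (k + 2) (x ∘ swap (Fin.castSucc a) (Fin.castSucc b)) =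
          frobeniusS T (k + 2) x := by
      intro a b x
      rw [← hcast (swap a b) x]
      congr 1
      ext i
      cases i using Fin.lastCases with
      | last =>
        simp [swap_apply_of_ne_of_ne (Fin.castSucc_lt_last a).ne' (Fin.castSucc_lt_last b).ne']
      | cast j =>
        simp [Fin.castSucc_injective _ |>.map_swap]
    -- the adjacent transposition of the two last slots
    have hadj : ∀ x : Fin (k + 2) → G,
        frobeniusS T (k + 2) (x ∘ swap (Fin.castSucc (Fin.last k)) (Fin.last (k + 1))) =
          frobeniusS T (k + 2) x := by
      intro x
      have hx : x = Fin.snoc (Fin.snoc (Fin.init (Fin.init x)) (x (Fin.castSucc (Fin.last k))) :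
          Fin (k + 1) → G) (x (Fin.last (k + 1))) := by
        ext i
        cases i using Fin.lastCases with
        | last => simp
        | cast j =>
          cases j using Fin.lastCases with
          | last => simp
          | cast j => simp [Fin.init]
      have hx' : x ∘ swap (Fin.castSucc (Fin.last k)) (Fin.last (k + 1)) =
          Fin.snoc (Fin.snoc (Fin.init (Fin.init x)) (x (Fin.last (k + 1))) : Fin (k + 1) → G)
            (x (Fin.castSucc (Fin.last k))) := by
        ext i
        cases i using Fin.lastCases with
        | last => simp [swap_apply_right]
        | cast j =>
          cases j using Fin.lastCases with
          | last => simp [swap_apply_left]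
          | cast j =>
            have h1 : (Fin.castSucc (Fin.castSucc j) : Fin (k + 2)) ≠ Fin.castSucc (Fin.last k) :=
              fun h => (Fin.castSucc_lt_last j).ne (Fin.castSucc_injective _ h)
            have h2 : (Fin.castSucc (Fin.castSucc j) : Fin (k + 2)) ≠ Fin.last (k + 1) :=
              (Fin.castSucc_lt_last _).ne
            simp [swap_apply_of_ne_of_ne h1 h2, Fin.init]
      rw [hx', ← frobeniusS_snoc_snoc_comm T hT, ← hx]
    -- every swap
    have hswap : ∀ (a b : Fin (k + 2)) (x : Fin (k + 2) → G), a ≠ b →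
        frobeniusS T (k + 2) (x ∘ swap a b) = frobeniusS T (k + 2) x := by
      -- first: swaps `swap a last` with `a ≠ last`
      have hlast : ∀ (a : Fin (k + 1)) (x : Fin (k + 2) → G),
          frobeniusS T (k + 2) (x ∘ swap (Fin.castSucc a) (Fin.last (k + 1))) =
            frobeniusS T (k + 2) x := by
        intro a x
        by_cases ha : a = Fin.last k
        · subst ha; exact hadj x
        · -- conjugate by `swap (castSucc a) (castSucc (last k))`
          set m : Fin (k + 2) := Fin.castSucc (Fin.last k) with hm
          have ham : Fin.castSucc a ≠ m := fun h => ha (Fin.castSucc_injective _ h)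
          have hal : Fin.castSucc a ≠ Fin.last (k + 1) := (Fin.castSucc_lt_last a).ne
          have hdecomp : swap (Fin.castSucc a) (Fin.last (k + 1)) =
              swap m (Fin.last (k + 1)) * swap (Fin.castSucc a) m * swap m (Fin.last (k + 1)) := by
            rw [swap_mul_swap_mul_swap ham hal, swap_comm]
          rw [hdecomp]
          change frobeniusS T (k + 2) (((x ∘ swap m (Fin.last (k + 1))) ∘ swap (Fin.castSucc a) m) ∘
            swap m (Fin.last (k + 1))) = _
          rw [hadj, hswap_cast, hadj]
      intro a b x hab
      cases a using Fin.lastCases with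
      | last =>
        cases b using Fin.lastCases with
        | last => exact absurd rfl hab
        | cast b => rw [swap_comm]; exact hlast b x
      | cast a =>
        cases b using Fin.lastCases with
        | last => exact hlast a x
        | cast b => exact hswap_cast a b x
    -- conclusion by swap induction
    intro σ
    induction σ using Perm.swap_induction_on with
    | one => intro x; rfl
    | swap_mul f a b hab hf =>
      intro x
      change frobeniusS T (k + 2) ((x ∘ swap a b) ∘ f) = _
      rw [hf, hswap a b x hab]

/-- Symmetry of `S_n(T)` under a transposition of two slots, `Function.update` form: for central
`T`, the value of `S_n(T)` at a constant tuple updated in one slot does not depend on the slot.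
[cite: Rouquier1996, §2 p. 572] -/
theorem frobeniusS_update_const_eq (T : G → A) (hT : ∀ a b : G, T (a * b) = T (b * a))
    (n : ℕ) (c v : G) (i j : Fin n) :
    frobeniusS T n (update (fun _ => c) i v) = frobeniusS T n (update (fun _ => c) j v) := by
  have h : update (fun _ : Fin n => c) i v = update (fun _ => c) j v ∘ swap i j := by
    ext l
    simp only [comp_apply, update_apply]
    by_cases hli : l = i
    · subst hli; simp
    · by_cases hlj : l = j
      · subst hlj
        simp [swap_apply_right, Ne.symm hli, hli]
      · simp [swap_apply_of_ne_of_ne hli hlj, hli, hlj]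
  rw [h, frobeniusS_comp_perm T hT]

end Symmetric

end Literature.NumberTheory.GaloisRepresentations
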